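import Summits.SmoothPoincare4.SmoothPoincare4.Theorems.CongruenceShadowsShadowApproximationStubLayerStepZeroTwoCalculus
import HarnessLib

/-!
# Helper V (the datum of a commutator, conjugated twists at arbitrary arguments) for stub `stub_layerStepZeroTwo`
of line `nilpotent-genus-class`, crux `CongruenceShadows.ShadowApproximation` (item stmt-SmoothPoincare4-14595)

Genus `3`, notation of the siblings (`Nᵢ = s4Kernels i`, `γₖ₊₁`, `𝒥ₖ`, the symbols `θₖ` of `F₃` and the erasing
projection `π : S₃ ↠ F₃` of `N₂` as hypotheses on variables, cut pattern `![true,false,false]`).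
* **`datum_comm`** — THE DEGREE-THREE DATUM OF A COMMUTATOR `V = x U x⁻¹ U⁻¹` (`x ∈ 𝒥₁`, `U ∈ 𝒥₂`) at `X`, given the
  class of `U(X)X⁻¹` modulo `γ₄` as `⁅⁅P,Q⁆,P⁆^{n_a} ⁅⁅P,Q⁆,Q⁆^{n_b}` and the class of `x(X)X⁻¹` modulo `γ₃` as
  `⁅A₁,B₁⁆^{m₁} ⁅A₂,B₂⁆^{m₂} ⁅A₃,B₃⁆^{m₃}`: `θ₃(π(V(X)X⁻¹)) = n_a E_a + n_b E_b - ∑ mᵢ Gᵢ` with `E`, `G` the derivation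
  expressions of `…Calculus` in the lower data of `x` at `P, Q` and of `U` at `Aᵢ, Bᵢ` (the group form of
  `τ₃[x,U] = [τ₁x, τ₂U]` evaluated through `π`).
* `conj_twist_class`, `datum_conj_twist'` — the value `U(t)t⁻¹` of a conjugated handle twist `U = g T_h g⁻¹` at an
  ARBITRARY `t` modulo `γ₄` (`= ⁅⁅P,Q⁆,P⁆^{n_a}⁅⁅P,Q⁆,Q⁆^{n_b}`, `P, Q = g(a_h), g(b_h)`, `n = F⁻¹[t]` on handle `h`) and
  its symbol (the sibling `datum_conj_twist` is the case of a cut letter).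
No definitions, no notations.
-/

set_option linter.dupNamespace false

noncomputable section

open Subgroup Literature.Topology.FourManifolds Literature.Algebra.Lie Multiplicative
open Summit.SmoothPoincare4.SmoothPoincare4.Theorems.NilpotentShadowsStandard.SaturatedTorsorDescent
open Literature.GroupTheory.CombinatorialGroupTheory (commutator_mem_lcs)
open scoped commutatorElement

namespace Summit.SmoothPoincare4.SmoothPoincare4.Theorems.ShadowApproximation.NilpotentGenusClass

namespace LayerZeroTwo

open LayerZeroOne

section Symbols

variable (θ : ℕ → FreeGroup (Fin 3) → FreeLieAlgebra ℤ (Fin 3))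
  (hadd : ∀ k, ∀ x ∈ (⊤ : Subgroup (FreeGroup (Fin 3))).lowerCentralSeries k,
    ∀ y ∈ (⊤ : Subgroup (FreeGroup (Fin 3))).lowerCentralSeries k, θ k (x * y) = θ k x + θ k y)
  (hker : ∀ k, ∀ x ∈ (⊤ : Subgroup (FreeGroup (Fin 3))).lowerCentralSeries k,
    θ k x = 0 ↔ x ∈ (⊤ : Subgroup (FreeGroup (Fin 3))).lowerCentralSeries (k + 1))
  (hof : ∀ i : Fin 3, θ 0 (FreeGroup.of i) = FreeLieAlgebra.of ℤ i)
  (hbr : ∀ j k, ∀ x ∈ (⊤ : Subgroup (FreeGroup (Fin 3))).lowerCentralSeries j,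
    ∀ y ∈ (⊤ : Subgroup (FreeGroup (Fin 3))).lowerCentralSeries k, θ (j + k + 1) ⁅x, y⁆ = ⁅θ j x, θ k y⁆)
  (π : SurfaceGroup 3 →* FreeGroup (Fin 3))
  (hπof : ∀ (h : Fin 3) (b : Bool), π (PresentedGroup.of (h, b)) = if b = (![true, false, false] : Fin 3 → Bool) h then 1 else FreeGroup.of h)

include hadd hker hbr in
/-- **The degree-three datum of a commutator.** For `x ∈ 𝒥₁`, `U ∈ 𝒥₂`, an element `X` with
`U(X)X⁻¹ ≡ ⁅⁅P,Q⁆,P⁆^{n_a} ⁅⁅P,Q⁆,Q⁆^{n_b} (mod γ₄)` and `x(X)X⁻¹ ≡ ⁅A₁,B₁⁆^{m₁}⁅A₂,B₂⁆^{m₂}⁅A₃,B₃⁆^{m₃} (mod γ₃)`, the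
commutator `V = x U x⁻¹ U⁻¹ ∈ 𝒥₃` has `θ₃(π(V(X)X⁻¹)) = n_a E_a + n_b E_b - (m₁ G₁ + m₂ G₂ + m₃ G₃)`, where
`E_R = ⁅⁅p,q⁆, x̂R⁆ + ⁅⁅p, x̂Q⁆ + ⁅x̂P, q⁆, r⁆` (`p = θ₀πP`, `x̂P = θ₁π(x(P)P⁻¹)`, …) and
`Gᵢ = ⁅aᵢ, ÛBᵢ⁆ + ⁅ÛAᵢ, bᵢ⁆` (`ÛA = θ₂π(U(A)A⁻¹)`). [folklore] -/
theorem datum_comm {x U : SurfaceGroup 3 ≃* SurfaceGroup 3}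
    (hx : ∀ s, x s * s⁻¹ ∈ (⊤ : Subgroup (SurfaceGroup 3)).lowerCentralSeries 1)
    (hU : ∀ s, U s * s⁻¹ ∈ (⊤ : Subgroup (SurfaceGroup 3)).lowerCentralSeries 2)
    (X P Q : SurfaceGroup 3) (na nb : ℤ)
    (hUX : ((U X * X⁻¹ : SurfaceGroup 3) : SurfaceGroup 3 ⧸ (⊤ : Subgroup (SurfaceGroup 3)).lowerCentralSeries 3) =
      ((⁅⁅P, Q⁆, P⁆ ^ na * ⁅⁅P, Q⁆, Q⁆ ^ nb : SurfaceGroup 3) : SurfaceGroup 3 ⧸ (⊤ : Subgroup (SurfaceGroup 3)).lowerCentralSeries 3))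
    (A₁ B₁ A₂ B₂ A₃ B₃ : SurfaceGroup 3) (m₁ m₂ m₃ : ℤ)
    (hxX : ((x X * X⁻¹ : SurfaceGroup 3) : SurfaceGroup 3 ⧸ (⊤ : Subgroup (SurfaceGroup 3)).lowerCentralSeries 2) =
      ((⁅A₁, B₁⁆ ^ m₁ * ⁅A₂, B₂⁆ ^ m₂ * ⁅A₃, B₃⁆ ^ m₃ : SurfaceGroup 3) :
        SurfaceGroup 3 ⧸ (⊤ : Subgroup (SurfaceGroup 3)).lowerCentralSeries 2)) :
    (⁅(x : MulAut (SurfaceGroup 3)), (U : MulAut (SurfaceGroup 3))⁆ : MulAut (SurfaceGroup 3)) X * X⁻¹ ∈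
      (⊤ : Subgroup (SurfaceGroup 3)).lowerCentralSeries 3 ∧
    θ 3 (π ((⁅(x : MulAut (SurfaceGroup 3)), (U : MulAut (SurfaceGroup 3))⁆ : MulAut (SurfaceGroup 3)) X * X⁻¹)) =
      na • (⁅⁅θ 0 (π P), θ 0 (π Q)⁆, θ 1 (π (x P * P⁻¹))⁆ +
          ⁅⁅θ 0 (π P), θ 1 (π (x Q * Q⁻¹))⁆ + ⁅θ 1 (π (x P * P⁻¹)), θ 0 (π Q)⁆, θ 0 (π P)⁆) +
      nb • (⁅⁅θ 0 (π P), θ 0 (π Q)⁆, θ 1 (π (x Q * Q⁻¹))⁆ +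
          ⁅⁅θ 0 (π P), θ 1 (π (x Q * Q⁻¹))⁆ + ⁅θ 1 (π (x P * P⁻¹)), θ 0 (π Q)⁆, θ 0 (π Q)⁆) -
      (m₁ • (⁅θ 0 (π A₁), θ 2 (π (U B₁ * B₁⁻¹))⁆ + ⁅θ 2 (π (U A₁ * A₁⁻¹)), θ 0 (π B₁)⁆) +
        m₂ • (⁅θ 0 (π A₂), θ 2 (π (U B₂ * B₂⁻¹))⁆ + ⁅θ 2 (π (U A₂ * A₂⁻¹)), θ 0 (π B₂)⁆) +
        m₃ • (⁅θ 0 (π A₃), θ 2 (π (U B₃ * B₃⁻¹))⁆ + ⁅θ 2 (π (U A₃ * A₃⁻¹)), θ 0 (π B₃)⁆)) := by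
  obtain ⟨hV3, hVq⟩ := comm_johnson hx hU X
  refine ⟨hV3, ?_⟩
  have hu2 : U X * X⁻¹ ∈ (⊤ : Subgroup (SurfaceGroup 3)).lowerCentralSeries 2 := hU X
  have hξ1 : x X * X⁻¹ ∈ (⊤ : Subgroup (SurfaceGroup 3)).lowerCentralSeries 1 := hx X
  have hα : x (U X * X⁻¹) * (U X * X⁻¹)⁻¹ ∈ (⊤ : Subgroup (SurfaceGroup 3)).lowerCentralSeries 3 := (jkm_mem x hx 2 hu2 :)
  have hβ : U (x X * X⁻¹) * (x X * X⁻¹)⁻¹ ∈ (⊤ : Subgroup (SurfaceGroup 3)).lowerCentralSeries 3 := (jkm_mem U hU 1 hξ1 :)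
  -- split `θ₃ ∘ π` along the commutator congruence
  have step1 : θ 3 (π ((⁅(x : MulAut (SurfaceGroup 3)), (U : MulAut (SurfaceGroup 3))⁆ : MulAut (SurfaceGroup 3)) X * X⁻¹)) =
      θ 3 (π (x (U X * X⁻¹) * (U X * X⁻¹)⁻¹)) - θ 3 (π (U (x X * X⁻¹) * (x X * X⁻¹)⁻¹)) := by
    rw [theta_pi_congr θ hadd hker π 3 (mul_mem hα (inv_mem hβ)) (by rw [hVq, ← QuotientGroup.mk_inv, ← QuotientGroup.mk_mul]),
      map_mul, hadd 3 _ (FreeGroupGrLie.map_mem_lcs π hα) _ (FreeGroupGrLie.map_mem_lcs π (inv_mem hβ)), map_inv,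
      theta_inv θ hadd 3 (FreeGroupGrLie.map_mem_lcs π hβ), sub_eq_add_neg]
  -- Term A: `x` on the class of `u = U(X)X⁻¹`
  have hDa : ⁅⁅P, Q⁆, P⁆ ∈ (⊤ : Subgroup (SurfaceGroup 3)).lowerCentralSeries 2 :=
    commutator_mem_commutator (commutator_mem_commutator (mem_top P) (mem_top Q)) (mem_top P)
  have hDb : ⁅⁅P, Q⁆, Q⁆ ∈ (⊤ : Subgroup (SurfaceGroup 3)).lowerCentralSeries 2 :=
    commutator_mem_commutator (commutator_mem_commutator (mem_top P) (mem_top Q)) (mem_top Q)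
  obtain ⟨hEa1, hEa2⟩ := theta3_x_comm_comm θ hadd hker hbr π hx P Q P
  obtain ⟨hEb1, hEb2⟩ := theta3_x_comm_comm θ hadd hker hbr π hx P Q Q
  have stepA : θ 3 (π (x (U X * X⁻¹) * (U X * X⁻¹)⁻¹)) =
      na • θ 3 (π (x ⁅⁅P, Q⁆, P⁆ * (⁅⁅P, Q⁆, P⁆)⁻¹)) + nb • θ 3 (π (x ⁅⁅P, Q⁆, Q⁆ * (⁅⁅P, Q⁆, Q⁆)⁻¹)) := by
    rw [← mul_inv_mem_iff_quot] at hUX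
    have h1 := jkm_congr hx 2 (mul_mem (zpow_mem hDa na) (zpow_mem hDb nb)) hUX
    rw [jkm_zpow_mul_zpow hx 2 hDa hDb, show (1 + 2 + 1 : ℕ) = 3 + 1 from rfl] at h1
    rw [theta_pi_congr θ hadd hker π 3 (mul_mem (zpow_mem hEa1 na) (zpow_mem hEb1 nb)) h1,
      theta_pi_zpow_mul_zpow θ hadd π 3 hEa1 hEb1]
  -- Term B: `U` on the class of `ξ = x(X)X⁻¹`
  have hc1 : ⁅A₁, B₁⁆ ∈ (⊤ : Subgroup (SurfaceGroup 3)).lowerCentralSeries 1 := commutator_mem_commutator (mem_top _) (mem_top _)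
  have hc2 : ⁅A₂, B₂⁆ ∈ (⊤ : Subgroup (SurfaceGroup 3)).lowerCentralSeries 1 := commutator_mem_commutator (mem_top _) (mem_top _)
  have hc3 : ⁅A₃, B₃⁆ ∈ (⊤ : Subgroup (SurfaceGroup 3)).lowerCentralSeries 1 := commutator_mem_commutator (mem_top _) (mem_top _)
  obtain ⟨hG11, hG12⟩ := theta3_U_comm θ hadd hker hbr π hU A₁ B₁
  obtain ⟨hG21, hG22⟩ := theta3_U_comm θ hadd hker hbr π hU A₂ B₂
  obtain ⟨hG31, hG32⟩ := theta3_U_comm θ hadd hker hbr π hU A₃ B₃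
  have stepB : θ 3 (π (U (x X * X⁻¹) * (x X * X⁻¹)⁻¹)) =
      m₁ • θ 3 (π (U ⁅A₁, B₁⁆ * (⁅A₁, B₁⁆)⁻¹)) + m₂ • θ 3 (π (U ⁅A₂, B₂⁆ * (⁅A₂, B₂⁆)⁻¹)) +
        m₃ • θ 3 (π (U ⁅A₃, B₃⁆ * (⁅A₃, B₃⁆)⁻¹)) := by
    rw [← mul_inv_mem_iff_quot] at hxX
    have h1 := jkm_congr hU 1 (mul_mem (mul_mem (zpow_mem hc1 m₁) (zpow_mem hc2 m₂)) (zpow_mem hc3 m₃)) hxX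
    rw [jkm_zpow_triple hU 1 hc1 hc2 hc3, show (2 + 1 + 1 : ℕ) = 3 + 1 from rfl] at h1
    rw [theta_pi_congr θ hadd hker π 3 (mul_mem (mul_mem (zpow_mem hG11 m₁) (zpow_mem hG21 m₂)) (zpow_mem hG31 m₃)) h1,
      theta_pi_zpow_triple θ hadd π 3 hG11 hG21 hG31]
  rw [step1, stepA, stepB, hEa2, hEb2, hG12, hG22, hG32]


/-- **The value of a conjugated handle twist at an arbitrary argument, modulo `γ₄`.** For `x ∈ Aut S₃` inducing `F`
on `H₁` and `T ∈ 𝒥₂` with the letter values of the handle twist `T_h`, the value of `U = x T x⁻¹` at `t` is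
`U(t)t⁻¹ ≡ ⁅⁅P,Q⁆,P⁆^{n_a} ⁅⁅P,Q⁆,Q⁆^{n_b} (mod γ₄)` with `P, Q = x(a_h), x(b_h)` and `(n_a, n_b)` the handle-`h`
coordinates of `F⁻¹[t]`. [folklore] -/
theorem conj_twist_class (x T : SurfaceGroup 3 ≃* SurfaceGroup 3) (F : (surfaceGen 3 → ℤ) ≃ₗ[ℤ] (surfaceGen 3 → ℤ))
    (hx : ∀ s, toAdd (SurfaceGroup.abelianize 3 (x s)) = F (toAdd (SurfaceGroup.abelianize 3 s))) (h : Fin 3)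
    (hT2 : ∀ s, T s * s⁻¹ ∈ (⊤ : Subgroup (SurfaceGroup 3)).lowerCentralSeries 2)
    (hTh : ∀ c : Bool, T (PresentedGroup.of (h, c)) * (PresentedGroup.of (h, c) : SurfaceGroup 3)⁻¹ =
      ⁅⁅(PresentedGroup.of (h, false) : SurfaceGroup 3), (PresentedGroup.of (h, true) : SurfaceGroup 3)⁆,
        (PresentedGroup.of (h, c) : SurfaceGroup 3)⁆)
    (hTne : ∀ y : surfaceGen 3, y.1 ≠ h → T (PresentedGroup.of y) = PresentedGroup.of y) (t : SurfaceGroup 3) :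
    (((x.symm.trans (T.trans x)) t * t⁻¹ : SurfaceGroup 3) : SurfaceGroup 3 ⧸ (⊤ : Subgroup (SurfaceGroup 3)).lowerCentralSeries 3) =
      ((⁅⁅x (PresentedGroup.of (h, false)), x (PresentedGroup.of (h, true))⁆, x (PresentedGroup.of (h, false))⁆ ^
            (F.symm (toAdd (SurfaceGroup.abelianize 3 t))) (h, false) *
          ⁅⁅x (PresentedGroup.of (h, false)), x (PresentedGroup.of (h, true))⁆, x (PresentedGroup.of (h, true))⁆ ^
            (F.symm (toAdd (SurfaceGroup.abelianize 3 t))) (h, true) : SurfaceGroup 3) :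
        SurfaceGroup 3 ⧸ (⊤ : Subgroup (SurfaceGroup 3)).lowerCentralSeries 3) := by
  obtain ⟨n, hn⟩ : ∃ n : surfaceGen 3 → ℤ, n = F.symm (toAdd (SurfaceGroup.abelianize 3 t)) := ⟨_, rfl⟩
  obtain ⟨a, ha⟩ : ∃ a : SurfaceGroup 3, a = PresentedGroup.of (h, false) := ⟨_, rfl⟩
  obtain ⟨b, hb⟩ : ∃ b : SurfaceGroup 3, b = PresentedGroup.of (h, true) := ⟨_, rfl⟩
  rw [← hn, ← ha, ← hb, conj_tau]
  obtain ⟨t', ht'⟩ : ∃ t', t' = x.symm t := ⟨_, rfl⟩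
  rw [← ht']
  -- the class of `t'`
  have habt : toAdd (SurfaceGroup.abelianize 3 t') = n := by
    have h1 := hx t'
    rw [ht', MulEquiv.apply_symm_apply] at h1
    rw [hn, h1, ← ht', LinearEquiv.symm_apply_apply]
  -- a product of powers of letters in the class of `t'`, handle `h` first
  obtain ⟨restF, hrestF⟩ : ∃ restF : Finset (surfaceGen 3), restF = Finset.univ.filter fun l => l.1 ≠ h := ⟨_, rfl⟩
  obtain ⟨r, hr⟩ : ∃ r : SurfaceGroup 3, r = (restF.toList.map fun l => (PresentedGroup.of l : SurfaceGroup 3) ^ n l).prod :=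
    ⟨_, rfl⟩
  obtain ⟨t₀, ht₀⟩ : ∃ t₀ : SurfaceGroup 3, t₀ = a ^ n (h, false) * b ^ n (h, true) * r := ⟨_, rfl⟩
  have hab_r : toAdd (SurfaceGroup.abelianize 3 r) = ∑ l ∈ restF, n l • Pi.single l (1 : ℤ) := by
    rw [hr, map_list_prod, List.map_map, Finset.prod_map_toList, toAdd_prod]
    refine Finset.sum_congr rfl fun l _ => ?_
    simp only [Function.comp_apply, map_zpow, SurfaceGroup.abelianize_of, toAdd_zpow, toAdd_ofAdd]
  have hab_t₀ : toAdd (SurfaceGroup.abelianize 3 t₀) = n := by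
    simp only [ht₀, MonoidHom.map_mul, MonoidHom.map_zpow, toAdd_mul, toAdd_zpow, hab_r, ha, hb,
      SurfaceGroup.abelianize_of, toAdd_ofAdd]
    have hsplit := Finset.sum_filter_add_sum_filter_not Finset.univ (fun l : surfaceGen 3 => l.1 ≠ h)
      (fun l => n l • Pi.single l (1 : ℤ))
    have hpair : (Finset.univ.filter fun l : surfaceGen 3 => ¬ l.1 ≠ h) = {(h, false), (h, true)} := by
      ext ⟨i, c⟩
      simp only [Finset.mem_filter, Finset.mem_univ, true_and, not_not, Finset.mem_insert, Finset.mem_singleton,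
        Prod.mk.injEq]
      cases c <;> simp
    have hsingle : ∀ l : surfaceGen 3, n l • (Pi.single l (1 : ℤ) : surfaceGen 3 → ℤ) =
        (Pi.single l (n l) : surfaceGen 3 → ℤ) := fun l => by
      ext y; by_cases hy : y = l
      · subst hy; simp
      · simp [Pi.single_eq_of_ne hy]
    rw [hpair, Finset.sum_pair (by simp)] at hsplit
    simp only [hsingle, Finset.univ_sum_single] at hsplit ⊢
    conv_rhs => rw [← hsplit]
    rw [hrestF]
    abel
  have htt₀ : t' * t₀⁻¹ ∈ (⊤ : Subgroup (SurfaceGroup 3)).lowerCentralSeries 1 :=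
    mul_inv_mem_γ₂ (habt.trans hab_t₀.symm)
  -- the value of `T` at `t'` modulo `γ₄`
  have hTr : T r = r := by
    rw [hr, map_list_prod, List.map_map]
    refine congrArg List.prod (List.map_congr_left fun l hl => ?_)
    rw [Finset.mem_toList, hrestF, Finset.mem_filter] at hl
    rw [Function.comp_apply, map_zpow, hTne l hl.2]
  have hval : (((T t' * t'⁻¹ : SurfaceGroup 3)) : SurfaceGroup 3 ⧸ (⊤ : Subgroup (SurfaceGroup 3)).lowerCentralSeries 3) =
      ((⁅⁅a, b⁆, a⁆ ^ n (h, false) * ⁅⁅a, b⁆, b⁆ ^ n (h, true) : SurfaceGroup 3) : SurfaceGroup 3 ⧸ _) := by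
    rw [jk_quot_congr hT2 htt₀, ht₀, jk_quot_mul hT2, jk_quot_mul hT2, jk_quot_zpow hT2, jk_quot_zpow hT2,
      hTr, mul_inv_cancel, QuotientGroup.mk_one, mul_one, ha, hb, hTh, hTh,
      QuotientGroup.mk_mul, QuotientGroup.mk_zpow, QuotientGroup.mk_zpow]
  -- push through `x`
  rw [← mul_inv_mem_iff_quot] at hval ⊢
  have h2 := equiv_mem_lcs x hval
  simpa only [map_mul, map_inv, map_zpow, map_commutatorElement] using h2

include hadd hker hbr in
/-- **The degree-two datum of a conjugated handle twist at an arbitrary argument**: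
`θ₂(π(U(t)t⁻¹)) = n_a ⁅⁅p,q⁆,p⁆ + n_b ⁅⁅p,q⁆,q⁆`, `p, q = θ₀π(x a_h), θ₀π(x b_h)`, `(n_a, n_b)` the handle-`h` coordinates
of `F⁻¹[t]` (the sibling `datum_conj_twist` is the case of a cut letter). [folklore] -/
theorem datum_conj_twist' (x T : SurfaceGroup 3 ≃* SurfaceGroup 3) (F : (surfaceGen 3 → ℤ) ≃ₗ[ℤ] (surfaceGen 3 → ℤ))
    (hx : ∀ s, toAdd (SurfaceGroup.abelianize 3 (x s)) = F (toAdd (SurfaceGroup.abelianize 3 s))) (h : Fin 3)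
    (hT2 : ∀ s, T s * s⁻¹ ∈ (⊤ : Subgroup (SurfaceGroup 3)).lowerCentralSeries 2)
    (hTh : ∀ c : Bool, T (PresentedGroup.of (h, c)) * (PresentedGroup.of (h, c) : SurfaceGroup 3)⁻¹ =
      ⁅⁅(PresentedGroup.of (h, false) : SurfaceGroup 3), (PresentedGroup.of (h, true) : SurfaceGroup 3)⁆,
        (PresentedGroup.of (h, c) : SurfaceGroup 3)⁆)
    (hTne : ∀ y : surfaceGen 3, y.1 ≠ h → T (PresentedGroup.of y) = PresentedGroup.of y) (t : SurfaceGroup 3) :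
    θ 2 (π ((x.symm.trans (T.trans x)) t * t⁻¹)) =
      (F.symm (toAdd (SurfaceGroup.abelianize 3 t))) (h, false) •
          ⁅⁅θ 0 (π (x (PresentedGroup.of (h, false)))), θ 0 (π (x (PresentedGroup.of (h, true))))⁆,
            θ 0 (π (x (PresentedGroup.of (h, false))))⁆ +
        (F.symm (toAdd (SurfaceGroup.abelianize 3 t))) (h, true) •
          ⁅⁅θ 0 (π (x (PresentedGroup.of (h, false)))), θ 0 (π (x (PresentedGroup.of (h, true))))⁆,
            θ 0 (π (x (PresentedGroup.of (h, true))))⁆ := by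
  have hval := conj_twist_class x T F hx h hT2 hTh hTne t
  have hm : ∀ R : SurfaceGroup 3, ⁅⁅x (PresentedGroup.of (h, false)), x (PresentedGroup.of (h, true))⁆, R⁆ ∈
      (⊤ : Subgroup (SurfaceGroup 3)).lowerCentralSeries 2 := fun R =>
    commutator_mem_commutator (commutator_mem_commutator (mem_top _) (mem_top _)) (mem_top _)
  rw [theta_pi_congr θ hadd hker π 2 (mul_mem (zpow_mem (hm _) _) (zpow_mem (hm _) _)) hval,
    theta_pi_zpow_mul_zpow θ hadd π 2 (hm _) (hm _)]
  simp only [map_commutatorElement, theta2_comm_comm θ hbr]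

end Symbols

end LayerZeroTwo

/-- **Registered helper `helper_layerZeroTwoConjTwistClass`** (sub-goal of stub `stub_layerStepZeroTwo`, item
stmt-SmoothPoincare4-14595): the value of a conjugated handle twist at an arbitrary argument modulo `γ₄`, in closed
form (commutators spelled out). [folklore] -/
theorem helper_layerZeroTwoConjTwistClass : ∀ (x T : Literature.Topology.FourManifolds.SurfaceGroup 3 ≃* Literature.Topology.FourManifolds.SurfaceGroup 3) (F : (Literature.Topology.FourManifolds.surfaceGen 3 → ℤ) ≃ₗ[ℤ] (Literature.Topology.FourManifolds.surfaceGen 3 → ℤ)), (∀ s : Literature.Topology.FourManifolds.SurfaceGroup 3, Multiplicative.toAdd (Literature.Topology.FourManifolds.SurfaceGroup.abelianize 3 (x s)) = F (Multiplicative.toAdd (Literature.Topology.FourManifolds.SurfaceGroup.abelianize 3 s))) → ∀ h : Fin 3, (∀ s : Literature.Topology.FourManifolds.SurfaceGroup 3, T s * s⁻¹ ∈ (⊤ : Subgroup (Literature.Topology.FourManifolds.SurfaceGroup 3)).lowerCentralSeries 2) → (∀ c : Bool, T (PresentedGroup.of (h, c)) * (PresentedGroup.of (h, c) : Literature.Topology.FourManifolds.SurfaceGroup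 3)⁻¹ = ((PresentedGroup.of (h, false) : Literature.Topology.FourManifolds.SurfaceGroup 3) * (PresentedGroup.of (h, true) : Literature.Topology.FourManifolds.SurfaceGroup 3) * (PresentedGroup.of (h, false) : Literature.Topology.FourManifolds.SurfaceGroup 3)⁻¹ * (PresentedGroup.of (h, true) : Literature.Topology.FourManifolds.SurfaceGroup 3)⁻¹) * (PresentedGroup.of (h, c) : Literature.Topology.FourManifolds.SurfaceGroup 3) * ((PresentedGroup.of (h, false) : Literature.Topology.FourManifolds.SurfaceGroup 3) * (PresentedGroup.of (h, true) : Literature.Topology.FourManifolds.SurfaceGroup 3) * (PresentedGroup.of (h, false) : Literature.Topology.FourManifolds.SurfaceGroup 3)⁻¹ * (PresentedGroup.of (h, true) : Literature.Topology.FourManifolds.SurfaceGroup 3)⁻¹)⁻¹ * (PresentedGroup.of (h, c) : Literature.Topology.FourManifolds.SurfaceGroup 3)⁻¹) → (∀ y : Literature.Topology.FourManifolds.surfaceGen 3, y.1 ≠ h → T (PresentedGroup.of y) = PresentedGroup.of y) → ∀ t : Literature.Topology.FourManifolds.SurfaceGroup 3, (((x.symm.trans (T.trans x)) t * t⁻¹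 : Literature.Topology.FourManifolds.SurfaceGroup 3) : Literature.Topology.FourManifolds.SurfaceGroup 3 ⧸ (⊤ : Subgroup (Literature.Topology.FourManifolds.SurfaceGroup 3)).lowerCentralSeries 3) = ((((x (PresentedGroup.of (h, false)) * x (PresentedGroup.of (h, true)) * (x (PresentedGroup.of (h, false)))⁻¹ * (x (PresentedGroup.of (h, true)))⁻¹) * x (PresentedGroup.of (h, false)) * (x (PresentedGroup.of (h, false)) * x (PresentedGroup.of (h, true)) * (x (PresentedGroup.of (h, false)))⁻¹ * (x (PresentedGroup.of (h, true)))⁻¹)⁻¹ * (x (PresentedGroup.of (h, false)))⁻¹) ^ (F.symm (Multiplicative.toAdd (Literature.Topology.FourManifolds.SurfaceGroup.abelianize 3 t))) (h, false) * ((x (PresentedGroup.of (h, false)) * x (PresentedGroup.of (h, true)) * (x (PresentedGroup.of (h, false)))⁻¹ * (x (PresentedGroup.of (h, true)))⁻¹) * x (PresentedGroup.of (h, true)) * (x (PresentedGroup.of (h, false)) * x (PresentedGroup.of (h, true)) * (x (PresentedGroup.of (h, false)))⁻¹ * (x (PresentedGroup.of (h, true)))⁻¹)⁻¹ * (x (PresentedGroup.of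 (h, true)))⁻¹) ^ (F.symm (Multiplicative.toAdd (Literature.Topology.FourManifolds.SurfaceGroup.abelianize 3 t))) (h, true) : Literature.Topology.FourManifolds.SurfaceGroup 3) : Literature.Topology.FourManifolds.SurfaceGroup 3 ⧸ (⊤ : Subgroup (Literature.Topology.FourManifolds.SurfaceGroup 3)).lowerCentralSeries 3) :=
  fun x T F hx h hT2 hTh hTne t => LayerZeroTwo.conj_twist_class x T F hx h hT2 hTh hTne t

end Summit.SmoothPoincare4.SmoothPoincare4.Theorems.ShadowApproximation.NilpotentGenusClass

end
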